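import Literature.AlgebraicGeometry.Motives.AbelianVarietyPermutationPowerCharacter
import HarnessLib

/-!
# The fixed part of a permutation power: `rk_ℤ Hom(B_H(A^S), B) = |H\S| · rk_ℤ Hom(A, B)` for every `B`, and
# `B_H(A^S) ∼ A^{S/H}` (Kani–Rosen's `ℚ`-characters `χ_B` on a permutation power)

Let `A^S` be a permutation power over a finite `G`-set `S` (bicone `b`, `Σ_s π_s ≫ ι_s = 𝟙`, action `ρ` with
`ι_s ≫ ρ(g) = ι_{g s}`, `Motives/AbelianVarietyPermutationPowerHom`), `H ≤ G` a finite subgroup, `N_H = Σ_{h ∈ H} ρ(h)` and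
`B_H = Im N_H ⊆ A^S` its Kani–Rosen factor.  The tree's ALGEBRAIC character `χ_B(u) = tr_ℤ(u ∘ − | Hom(X, B))`
(`Motives/AbelianVarietyIdempotentRelations`: `χ_B(u) = a · rk Hom(Im u, B)` for `u² = a u`) is computed on a permutation
power exactly as the `ℓ`-adic one (`Motives/AbelianVarietyPermutationPowerCharacter`), with `Hom(−, B)` in place of `T_ℓ`:

* §1 `Hom(A^S, B) ≅ Hom(A, B)^S`: **`rk_ℤ Hom(A^S, B) = |S| · rk_ℤ Hom(A, B)`** and the block formula
  **`tr(u ∘ − | Hom(A^S, B)) = Σ_s tr((ι_s ≫ u ≫ π_s) ∘ − | Hom(A, B))`**;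
* §2 **`χ_B(ρ(g)) = tr(ρ(g) ∘ − | Hom(A^S, B)) = |S^g| · rk_ℤ Hom(A, B)`** (the permutation character again, Serre Ex. 2.2), and for
  a twisted action `ι_s ≫ ρ(g) = α(g) ≫ ι_{g s}`: `= |S^g| · χ_B(α(g))`;
* §3 over ANY field: **`rk_ℤ Hom(B_H(A^S), B) = |H\S| · rk_ℤ Hom(A, B)`** for every abelian variety `B`
  (`|H| rk Hom(B_H, B) = χ_B(N_H) = Σ_h |S^h| rk Hom(A, B)`, Burnside) — `B_H` and `A^{S/H}` have the same `Hom`-counts;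
* §4 over a PERFECT field (the tree's Hom-count isogeny criterion `isIsogenous_iff_forall_finrank_hom_eq'` of
  `Motives/AbelianVarietyIsogenyCancellation`): **`B_H(A^S) ∼ ⨁_{H\S} A = A^{S/H}`** (`isIsogenous_image_norm_permAction_biproduct`,
  and `isIsogenous_image_norm_permAction_of_permPower` for any power over the orbit set); for a transitive action
  **`B_G(A^S) ∼ A`** (the diagonal; e.g. `(E^n)^{𝔖_n} ∼ E`); in particular, for the regular power, `B_H(A^G) ∼ A^{H\G}`.

Everything is a theorem (no definitions).  The statements of §§1–3 hold over any field; §4 needs `K` perfect only through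
the cited criterion.

## References

* [KaniRosen1989] E. Kani, M. Rosen, *Idempotent relations and factors of Jacobians*, Math. Ann. 284 (1989), §2 (the characters
  `χ` of `End⁰`), §3 Thm. B (`ε_H = |H|⁻¹ Σ h`).
* [SerreLinearRepresentations1977] J.-P. Serre, *Linear Representations of Finite Groups*, GTM 42 (1977), §2.3 Ex. 2.2, Ex. 2.6 (a).
* [JordanEtAl2018] B. W. Jordan et al., *Abelian varieties isogenous to a power of an elliptic curve*, Compos. Math. 154 (2018),
  §4.1 and Thm. 4.4 (c) (images of maps between powers are again power objects `𝓗𝓞𝓜_R(N, E)`).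
* [LangeRodriguez2022] H. Lange, R. E. Rodríguez, *Decomposition of Jacobians by Prym Varieties*, LNM 2310 (2022), §2.9.1
  Prop. 2.9.3, Cor. 3.5.10 (PDF pp. 46, 93).
* [Milne1986AbelianVarieties] J. S. Milne, *Abelian varieties*, in Cornell–Silverman (1986), §12 p. 122 (Hom counts along a
  decomposition up to isogeny).
* [MumfordAV1970] D. Mumford, *Abelian Varieties* (1970), §19 Thm. 3 (p. 176).
-/

noncomputable section

open CategoryTheory CategoryTheory.Limits MulAction
open Literature.NumberTheory.DiophantineGeometry

universe u

namespace Literature.AlgebraicGeometry.Motives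

namespace AbelianVariety

variable {K : Type u} [Field K]

/-! ## §1 `Hom(A^S, B) = Hom(A, B)^S`: rank and block traces -/

section HomOfPower

variable {A X' : AbelianVariety K} (B : AbelianVariety K) {S : Type} [Fintype S] (b : Bicone (fun _ : S ↦ A))

/-- **`rk_ℤ Hom(A^S, B) = |S| · rk_ℤ Hom(A, B)`** for a power (bicone with `Σ_s π_s ≫ ι_s = 𝟙`): `f ↦ (ι_s ≫ f)_s` identifies
`Hom(A^S, B)` with `Hom(A, B)^S` (the tree's `finrank_hom_eq_sum_of_quasiDecomposition` with `N = 1`).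
[cite: MumfordAV1970, §19 Thm. 3 (p. 176) and p. 173] [cite: Milne1986AbelianVarieties, §12 p. 122] -/
theorem finrank_hom_permPower_eq (hb : ∑ s, b.π s ≫ b.ι s = 𝟙 b.pt) :
    Module.finrank ℤ (b.pt ⟶ B) = Fintype.card S * Module.finrank ℤ (A ⟶ B) := by
  rw [finrank_hom_eq_sum_of_quasiDecomposition (S := fun _ : S ↦ A) b.ι b.π one_pos
    (fun s ↦ by rw [bicone_ι_π_self, one_smul]) (fun s t hst ↦ bicone_ι_π_ne b hst) (by rw [hb, one_smul]) B,
    Finset.sum_const, Finset.card_univ, smul_eq_mul]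

/-- **`rk_ℤ Hom(X', A^S) = |S| · rk_ℤ Hom(X', A)`**: `f ↦ (f ≫ π_s)_s` identifies `Hom(X', A^S)` with `Hom(X', A)^S` (the
universal property of the power object). [cite: JordanEtAl2018, §4.1 (`Hom(C, 𝓗𝓞𝓜_R(M, E)) ≅ Hom_R(M, Hom(C, E))`)]
[cite: MumfordAV1970, §19 Thm. 3 (p. 176) and p. 173] -/
theorem finrank_hom_permPower_target_eq (hb : ∑ s, b.π s ≫ b.ι s = 𝟙 b.pt) :
    Module.finrank ℤ (X' ⟶ b.pt) = Fintype.card S * Module.finrank ℤ (X' ⟶ A) := by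
  classical
  haveI : Module.Free ℤ (X' ⟶ A) := module_free_hom_holds X' A
  haveI : Module.Finite ℤ (X' ⟶ A) := module_finite_hom_holds X' A
  let e : (X' ⟶ b.pt) ≃+ (S → (X' ⟶ A)) :=
    { toFun := fun f s ↦ f ≫ b.π s
      invFun := fun u ↦ ∑ s, u s ≫ b.ι s
      left_inv := fun f ↦ (eq_sum_comp_π_comp_ι b hb f).symm
      right_inv := fun u ↦ funext fun s ↦ sum_comp_ι_comp_π b u s
      map_add' := fun f f' ↦ funext fun s ↦ Preadditive.add_comp _ _ _ _ _ _ }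
  calc Module.finrank ℤ (X' ⟶ b.pt) = Module.finrank ℤ (S → (X' ⟶ A)) := by convert e.toIntLinearEquiv.finrank_eq using 2
    _ = Fintype.card S * Module.finrank ℤ (X' ⟶ A) := by
        rw [Module.finrank_pi_fintype ℤ, Finset.sum_const, Finset.card_univ, smul_eq_mul]

/-- **The block formula for `χ_B`: `tr(u ∘ − | Hom(A^S, B)) = Σ_s tr((ι_s ≫ u ≫ π_s) ∘ − | Hom(A, B))`** — `u = Σ_s π_s ≫ ι_s ≫ u`,
`(π_s ≫ w) ∘ − = (π_s ∘ −) ∘ (w ∘ −)` and `tr(PQ) = tr(QP)` on the free `ℤ`-modules `Hom(A^S, B)`, `Hom(A, B)`.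
[cite: KaniRosen1989, §2 (the characters `χ`)] [cite: MumfordAV1970, §19 Thm. 3 (p. 176)] -/
theorem trace_leftComp_permPower_eq_sum (hb : ∑ s, b.π s ≫ b.ι s = 𝟙 b.pt) (u : b.pt ⟶ b.pt) :
    LinearMap.trace ℤ (b.pt ⟶ B) (Preadditive.leftComp B u).toIntLinearMap =
      ∑ s, LinearMap.trace ℤ (A ⟶ B) (Preadditive.leftComp B (b.ι s ≫ u ≫ b.π s)).toIntLinearMap := by
  haveI : Module.Free ℤ (A ⟶ B) := module_free_hom_holds A B
  haveI : Module.Finite ℤ (A ⟶ B) := module_finite_hom_holds A B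
  haveI : Module.Free ℤ (b.pt ⟶ B) := module_free_hom_holds b.pt B
  haveI : Module.Finite ℤ (b.pt ⟶ B) := module_finite_hom_holds b.pt B
  -- `u ∘ − = Σ_s (π_s ∘ −) ∘ ((ι_s ≫ u) ∘ −)`
  have hsum : (Preadditive.leftComp B u).toIntLinearMap =
      ∑ s, (Preadditive.leftComp B (b.π s)).toIntLinearMap ∘ₗ (Preadditive.leftComp B (b.ι s ≫ u)).toIntLinearMap := by
    refine LinearMap.ext fun f ↦ ?_
    rw [LinearMap.sum_apply]
    change u ≫ f = ∑ s, b.π s ≫ ((b.ι s ≫ u) ≫ f)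
    conv_lhs => rw [eq_sum_π_comp_ι_comp b hb u, Preadditive.sum_comp]
    simp only [Category.assoc]
  rw [hsum, map_sum]
  refine Finset.sum_congr rfl fun s _ ↦ ?_
  have hcomp : (Preadditive.leftComp B (b.ι s ≫ u)).toIntLinearMap ∘ₗ (Preadditive.leftComp B (b.π s)).toIntLinearMap =
      (Preadditive.leftComp B (b.ι s ≫ u ≫ b.π s)).toIntLinearMap := by
    refine LinearMap.ext fun f ↦ ?_
    change (b.ι s ≫ u) ≫ b.π s ≫ f = (b.ι s ≫ u ≫ b.π s) ≫ f
    simp only [Category.assoc]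
  rw [LinearMap.trace_comp_comm', hcomp]

end HomOfPower

/-! ## §2 `χ_B(ρ(g)) = |S^g| · rk_ℤ Hom(A, B)` -/

section Character

variable {A : AbelianVariety K} (B : AbelianVariety K) {S : Type} [Fintype S] (b : Bicone (fun _ : S ↦ A))
  {G : Type} [Group G] [MulAction G S] (ρ : G →* End b.pt)

/-- **`χ_B(ρ(g)) = tr(ρ(g) ∘ − | Hom(A^S, B)) = |S^g| · rk_ℤ Hom(A, B)`** for the permutation action (diagonal blocks
`ι_s ≫ ρ(g) ≫ π_s = δ_{g s, s}`; `tr(𝟙 ∘ −) = rk Hom(A, B)`): the permutation character, now for the functor `Hom(−, B)`.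
[cite: SerreLinearRepresentations1977, §2.3 Ex. 2.2] [cite: KaniRosen1989, §2] -/
theorem trace_leftComp_permAction_eq (hb : ∑ s, b.π s ≫ b.ι s = 𝟙 b.pt)
    (hρ : ∀ (g : G) (s : S), b.ι s ≫ End.asHom (ρ g) = b.ι (g • s)) (g : G) :
    LinearMap.trace ℤ (b.pt ⟶ B) (Preadditive.leftComp B (End.asHom (ρ g))).toIntLinearMap =
      ((MulAction.fixedBy S g).ncard * Module.finrank ℤ (A ⟶ B) : ℕ) := by
  classical
  haveI : Module.Free ℤ (A ⟶ B) := module_free_hom_holds A B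
  haveI : Module.Finite ℤ (A ⟶ B) := module_finite_hom_holds A B
  rw [trace_leftComp_permPower_eq_sum B b hb]
  have hdiag : ∀ s : S, LinearMap.trace ℤ (A ⟶ B) (Preadditive.leftComp B (b.ι s ≫ End.asHom (ρ g) ≫ b.π s)).toIntLinearMap =
      if g • s = s then (Module.finrank ℤ (A ⟶ B) : ℤ) else 0 := fun s ↦ by
    rw [ι_comp_asHom_permAction_comp_π b ρ hρ g s s]
    split_ifs
    · rw [show (Preadditive.leftComp B (𝟙 A)).toIntLinearMap = LinearMap.id from
        LinearMap.ext fun f ↦ Category.id_comp f, LinearMap.trace_id]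
    · rw [show (Preadditive.leftComp B (0 : A ⟶ A)).toIntLinearMap = 0 from
        LinearMap.ext fun f ↦ by change (0 : A ⟶ A) ≫ f = 0; exact zero_comp, map_zero]
  have hcard : (Finset.univ.filter fun s : S ↦ g • s = s).card = (MulAction.fixedBy S g).ncard := by
    rw [← Set.ncard_coe_finset]
    exact congrArg Set.ncard (Set.ext fun s ↦ by simp)
  rw [Finset.sum_congr rfl fun s _ ↦ hdiag s, Finset.sum_ite, Finset.sum_const_zero, add_zero, Finset.sum_const,
    nsmul_eq_mul, hcard, Nat.cast_mul]

variable (α : G →* End A)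

/-- **Twisted actions: `χ_B(ρ(g)) = |S^g| · χ_B(α(g))`** when `ι_s ≫ ρ(g) = α(g) ≫ ι_{g s}` (monomial matrices).
[cite: SerreLinearRepresentations1977, §2.3 Ex. 2.2 and §1.5] [cite: KaniRosen1989, §2] -/
theorem trace_leftComp_twistedPermAction_eq (hb : ∑ s, b.π s ≫ b.ι s = 𝟙 b.pt)
    (hρ : ∀ (g : G) (s : S), b.ι s ≫ End.asHom (ρ g) = End.asHom (α g) ≫ b.ι (g • s)) (g : G) :
    LinearMap.trace ℤ (b.pt ⟶ B) (Preadditive.leftComp B (End.asHom (ρ g))).toIntLinearMap =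
      (MulAction.fixedBy S g).ncard * LinearMap.trace ℤ (A ⟶ B) (Preadditive.leftComp B (End.asHom (α g))).toIntLinearMap := by
  classical
  rw [trace_leftComp_permPower_eq_sum B b hb]
  have hdiag : ∀ s : S, LinearMap.trace ℤ (A ⟶ B) (Preadditive.leftComp B (b.ι s ≫ End.asHom (ρ g) ≫ b.π s)).toIntLinearMap =
      if g • s = s then LinearMap.trace ℤ (A ⟶ B) (Preadditive.leftComp B (End.asHom (α g))).toIntLinearMap else 0 :=
    fun s ↦ by
    rw [← Category.assoc, hρ g s, Category.assoc]
    by_cases h : g • s = s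
    · rw [if_pos h]
      conv_lhs => rw [h, bicone_ι_π_self]
      erw [Category.comp_id]
    · rw [if_neg h, bicone_ι_π_ne b h, comp_zero,
        show (Preadditive.leftComp B (0 : A ⟶ A)).toIntLinearMap = 0 from
          LinearMap.ext fun f ↦ by change (0 : A ⟶ A) ≫ f = 0; exact zero_comp, map_zero]
  have hcard : (Finset.univ.filter fun s : S ↦ g • s = s).card = (MulAction.fixedBy S g).ncard := by
    rw [← Set.ncard_coe_finset]
    exact congrArg Set.ncard (Set.ext fun s ↦ by simp)
  rw [Finset.sum_congr rfl fun s _ ↦ hdiag s, Finset.sum_ite, Finset.sum_const_zero, add_zero, Finset.sum_const,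
    nsmul_eq_mul, hcard]

end Character

/-! ## §3 `rk_ℤ Hom(B_H(A^S), B) = |H\S| · rk_ℤ Hom(A, B)` over any field -/

section FixedPart

variable {A : AbelianVariety K} (B : AbelianVariety K) {S : Type} [Fintype S] (b : Bicone (fun _ : S ↦ A))
  {G : Type} [Group G] [MulAction G S] (ρ : G →* End b.pt)

/-- **`rk_ℤ Hom(B_G(A^S), B) = |G\S| · rk_ℤ Hom(A, B)` for every abelian variety `B`** (`G` finite, `N_G = Σ_g ρ(g)`,
`B_G = Im N_G`, any field): `|G| · rk Hom(B_G, B) = χ_B(N_G) = Σ_g χ_B(ρ(g)) = Σ_g |S^g| · rk Hom(A, B) = |G\S| · |G| · rk Hom(A, B)`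
(`χ_B(u) = a rk Hom(Im u, B)` for `u² = a u`, the tree's `trace_leftComp_eq_mul_finrank`; Burnside).  So `B_G(A^S)` and
`A^{S/G}` have the same `Hom`-counts into every `B`. [cite: KaniRosen1989, §2 and §3 Thm. B]
[cite: SerreLinearRepresentations1977, §2.3 Ex. 2.6 (a)] [cite: Milne1986AbelianVarieties, §12 p. 122] -/
theorem finrank_hom_image_normG_permAction_eq [Fintype G] (hb : ∑ s, b.π s ≫ b.ι s = 𝟙 b.pt)
    (hρ : ∀ (g : G) (s : S), b.ι s ≫ End.asHom (ρ g) = b.ι (g • s)) {NG : b.pt ⟶ b.pt} (hNG : End.of NG = ∑ g, ρ g) :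
    Module.finrank ℤ (image NG ⟶ B) = Nat.card (Quotient (MulAction.orbitRel G S)) * Module.finrank ℤ (A ⟶ B) := by
  classical
  have hχ := trace_leftComp_eq_mul_finrank B (normG_comp_normG_eq_card_nsmul ρ hNG)
  have hNG' : NG = ∑ g, (1 : ℤ) • End.asHom (ρ g) := by
    rw [Finset.sum_congr rfl fun g _ ↦ one_zsmul (End.asHom (ρ g))]
    exact hNG
  have hsum : LinearMap.trace ℤ (b.pt ⟶ B) (Preadditive.leftComp B NG).toIntLinearMap =
      ((Nat.card (Quotient (MulAction.orbitRel G S)) * Fintype.card G * Module.finrank ℤ (A ⟶ B) : ℕ) : ℤ) := by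
    rw [hNG', trace_leftComp_sum_zsmul]
    simp_rw [one_mul, trace_leftComp_permAction_eq B b ρ hb hρ]
    rw [← Nat.cast_sum, ← Finset.sum_mul]
    congr 2
    have hB := MulAction.sum_card_fixedBy_eq_card_orbits_mul_card_group G S
    rw [Nat.card_eq_fintype_card, ← hB]
    exact Finset.sum_congr rfl fun g _ ↦ by rw [Set.ncard_eq_toFinset_card', Set.toFinset_card]
  rw [hsum] at hχ
  have h' : Fintype.card G * Module.finrank ℤ (image NG ⟶ B) =
      Fintype.card G * (Nat.card (Quotient (MulAction.orbitRel G S)) * Module.finrank ℤ (A ⟶ B)) := by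
    have := hχ.symm
    push_cast at this
    have h2 : (Fintype.card G : ℤ) * Module.finrank ℤ (image NG ⟶ B) =
        (Fintype.card G : ℤ) * (Nat.card (Quotient (MulAction.orbitRel G S)) * Module.finrank ℤ (A ⟶ B)) := by
      rw [this]; ring
    exact_mod_cast h2
  exact Nat.eq_of_mul_eq_mul_left Fintype.card_pos h'

/-- **`rk_ℤ Hom(B_H(A^S), B) = |H\S| · rk_ℤ Hom(A, B)`** for a finite subgroup `H` (`N_H = Σ_{h ∈ H} ρ(h)`, `B_H = Im N_H`,
any field, every `B`). [cite: KaniRosen1989, §2 and §3 Thm. B] [cite: SerreLinearRepresentations1977, §2.3 Ex. 2.6 (a)]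
[cite: LangeRodriguez2022, §2.9.1 Prop. 2.9.3 (PDF p. 46)] -/
theorem finrank_hom_image_norm_permAction_eq {H : Subgroup G} [Fintype H] (hb : ∑ s, b.π s ≫ b.ι s = 𝟙 b.pt)
    (hρ : ∀ (g : G) (s : S), b.ι s ≫ End.asHom (ρ g) = b.ι (g • s)) {N : b.pt ⟶ b.pt} (hN : End.of N = ∑ h : H, ρ h) :
    Module.finrank ℤ (image N ⟶ B) = Nat.card (Quotient (MulAction.orbitRel H S)) * Module.finrank ℤ (A ⟶ B) :=
  finrank_hom_image_normG_permAction_eq B b (ρ.comp H.subtype) hb (fun h s ↦ hρ (h : G) s) hN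

end FixedPart

/-! ## §4 `B_H(A^S) ∼ A^{S/H}` over a perfect field -/

section Isogeny

variable [PerfectField K] {A : AbelianVariety K} {S : Type} [Fintype S] (b : Bicone (fun _ : S ↦ A))
  {G : Type} [Group G] [MulAction G S] (ρ : G →* End b.pt)

/-- **`B_G(A^S) ∼ ⨁_{G\S} A`** over a perfect field (`G` finite, `N_G = Σ_g ρ(g)`, `B_G = Im N_G`): both sides have
`rk Hom(−, B) = |G\S| · rk Hom(A, B)` for every `B`, and over a perfect field equal `Hom`-counts characterise the isogeny class
(the tree's `isIsogenous_iff_forall_finrank_hom_eq'`).  The fixed part of `A ⊗ ℤ[S]` is `A ⊗ ℤ[S]^G = A ⊗ ℤ[G\S]` up to isogeny.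
[cite: KaniRosen1989, §3 Thm. B] [cite: JordanEtAl2018, Thm. 4.4 (c)] [cite: Milne1986AbelianVarieties, §12 p. 122]
[cite: LangeRodriguez2022, §2.9.1 Prop. 2.9.3 and Cor. 3.5.10] -/
theorem isIsogenous_image_normG_permAction_biproduct [Fintype G] (hb : ∑ s, b.π s ≫ b.ι s = 𝟙 b.pt)
    (hρ : ∀ (g : G) (s : S), b.ι s ≫ End.asHom (ρ g) = b.ι (g • s)) {NG : b.pt ⟶ b.pt} (hNG : End.of NG = ∑ g, ρ g) :
    IsIsogenous (image NG) (⨁ fun _ : Quotient (MulAction.orbitRel G S) ↦ A) := by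
  classical
  refine isIsogenous_iff_forall_finrank_hom_eq'.2 fun B ↦ ?_
  rw [finrank_hom_image_normG_permAction_eq B b ρ hb hρ hNG, finrank_hom_biproduct_const, Nat.card_eq_fintype_card]

/-- **`B_H(A^S) ∼ ⨁_{H\S} A`** for a finite subgroup `H` (perfect field; `N_H = Σ_{h ∈ H} ρ(h)`).
[cite: KaniRosen1989, §3 Thm. B] [cite: LangeRodriguez2022, §2.9.1 Prop. 2.9.3 and Cor. 3.5.10] -/
theorem isIsogenous_image_norm_permAction_biproduct {H : Subgroup G} [Fintype H] (hb : ∑ s, b.π s ≫ b.ι s = 𝟙 b.pt)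
    (hρ : ∀ (g : G) (s : S), b.ι s ≫ End.asHom (ρ g) = b.ι (g • s)) {N : b.pt ⟶ b.pt} (hN : End.of N = ∑ h : H, ρ h) :
    IsIsogenous (image N) (⨁ fun _ : Quotient (MulAction.orbitRel H S) ↦ A) :=
  isIsogenous_image_normG_permAction_biproduct b (ρ.comp H.subtype) hb (fun h s ↦ hρ (h : G) s) hN

/-- **`B_G(A^S) ∼ A^{S/G}` for ANY power over the orbit set** (a bicone `c` over `(A)_{ω ∈ G\S}` with `Σ π_ω ≫ ι_ω = 𝟙`; perfect
field, `G` finite). [cite: KaniRosen1989, §3 Thm. B] [cite: JordanEtAl2018, Thm. 4.4 (c)] -/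
theorem isIsogenous_image_normG_permAction_of_permPower [Fintype G] [Fintype (Quotient (MulAction.orbitRel G S))]
    (c : Bicone (fun _ : Quotient (MulAction.orbitRel G S) ↦ A)) (hc : ∑ ω, c.π ω ≫ c.ι ω = 𝟙 c.pt)
    (hb : ∑ s, b.π s ≫ b.ι s = 𝟙 b.pt) (hρ : ∀ (g : G) (s : S), b.ι s ≫ End.asHom (ρ g) = b.ι (g • s))
    {NG : b.pt ⟶ b.pt} (hNG : End.of NG = ∑ g, ρ g) :
    IsIsogenous (image NG) c.pt := by
  refine isIsogenous_iff_forall_finrank_hom_eq'.2 fun B ↦ ?_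
  rw [finrank_hom_image_normG_permAction_eq B b ρ hb hρ hNG, finrank_hom_permPower_eq B c hc, Nat.card_eq_fintype_card]

/-- **`B_G(A^S) ∼ A` for a TRANSITIVE finite `G`-set** (perfect field): the fixed part of a transitive permutation power is the
diagonal copy of `A` up to isogeny — e.g. `(E^n)^{𝔖_n} ∼ E`, `B_G(A^{G/H}) ∼ A`, `B_G(A ⊗ ℤ[G]) ∼ A`.
[cite: SerreLinearRepresentations1977, §2.3 Ex. 2.6 (a) and §1.3 Example] [cite: KaniRosen1989, §3 Thm. B] -/
theorem isIsogenous_image_normG_permAction_of_isPretransitive [Fintype G] [Nonempty S] [MulAction.IsPretransitive G S]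
    (hb : ∑ s, b.π s ≫ b.ι s = 𝟙 b.pt) (hρ : ∀ (g : G) (s : S), b.ι s ≫ End.asHom (ρ g) = b.ι (g • s))
    {NG : b.pt ⟶ b.pt} (hNG : End.of NG = ∑ g, ρ g) :
    IsIsogenous (image NG) A := by
  refine isIsogenous_iff_forall_finrank_hom_eq'.2 fun B ↦ ?_
  rw [finrank_hom_image_normG_permAction_eq B b ρ hb hρ hNG]
  have h1 : Nat.card (Quotient (MulAction.orbitRel G S)) = 1 := by
    rw [Nat.card_eq_one_iff_unique]
    refine ⟨⟨fun x y ↦ ?_⟩, ⟨Quotient.mk _ (Classical.arbitrary S)⟩⟩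
    induction x using Quotient.inductionOn with
    | h a =>
      induction y using Quotient.inductionOn with
      | h a' => exact Quotient.sound (MulAction.mem_orbit_iff.2 (MulAction.exists_smul_eq G a' a))
  rw [h1, one_mul]

end Isogeny

end AbelianVariety

end Literature.AlgebraicGeometry.Motives
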